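import Summits.HubbardSuperconductivity.HubbardSuperconductivity.Theses.WeakCouplingBCS
import HarnessLib

/-!
# WeakCouplingBCS / `WcbcsSectorBookkeeping` (item stmt-HubbardSuperconductivity-0160) — proof

Route `WeakCouplingBCS` of `HubbardSuperconductivity`, support item #5 (sector bookkeeping shared
by every assembly of the survey): from the hypothesis block of the summit/thesis
(`N_L = 2⌊(1-δ)L²/2⌋`, `‖ψ_L‖ = 1`, `ψ_L` a ground state of `hubbardTorus 2 L 1 U` in the sector
`(N_L, S^z = 0)`) one gets (i) the particle-number/normalisation clause of `HasPairFieldLRO`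
(`szSector N 0 ≤ nParticleSubmodule N`, `mem_szSector_iff`) and (ii) the density lower bound
`(1-δ)/2 · L² ≤ N_L` for all large `L` (`2⌊y⌋ ≥ 2y - 2 ≥ y` once `y = (1-δ)L²/2 ≥ 2`, i.e.
`L² ≥ 4/(1-δ)`). Elementary; Lieb, PRL 62 (1989) 1201 (sectors). No definition is introduced.
-/

namespace Summit.HubbardSuperconductivity.WeakCouplingBCS

open Filter Literature.MathematicalPhysics.QuantumLattice
open Summit.HubbardSuperconductivity.HubbardSuperconductivity.Theses.WeakCouplingBCS

/-- **Record of the dropped route item `WcbcsSectorBookkeeping`** =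
stmt-HubbardSuperconductivity-0160 (ledger signature verbatim; NOT a route item): the route no longer declares this constant (repair by `restate`/`drop`), while
the theorem below — which closed the item `proved` and is recorded as its `closed_by` — still
refers to it. Re-declared here under its original fully-qualified name and definiens solely
so that this record keeps elaborating (Theorems files are append-only: the theorem's statement
text may not change). It is TRUE (proved below); the route dropped it at rev 2 as not load-bearing. -/
def _root_.Summit.HubbardSuperconductivity.HubbardSuperconductivity.Theses.WeakCouplingBCS.WcbcsSectorBookkeeping : Prop :=
    ∀ (U δ : ℝ), δ ∈ Set.Ioo (0:ℝ) 1 → ∀ (N : ℕ → ℕ) (ψ : ∀ L,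
    Literature.MathematicalPhysics.QuantumLattice.Fock
    (Literature.MathematicalPhysics.QuantumLattice.Orb
    (Literature.MathematicalPhysics.QuantumLattice.FermionTorus 2 L))), (∀ L, N L = 2 * ⌊(1 - δ) *
    (L : ℝ) ^ 2 / 2⌋₊ ∧ star (ψ L) ⬝ᵥ ψ L = 1 ∧
    Literature.MathematicalPhysics.QuantumLattice.IsGroundStateInSector
    (Literature.MathematicalPhysics.QuantumLattice.hubbardTorus 2 L 1 U) (N L) 0 (ψ L)) → (∀ L,
    Literature.MathematicalPhysics.QuantumLattice.IsNParticle (N L) (ψ L) ∧ star (ψ L) ⬝ᵥ ψ L = 1) ∧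
    ∀ᶠ L : ℕ in Filter.atTop, (1 - δ) / 2 * (L : ℝ) ^ 2 ≤ (N L : ℝ)

/-- Density bookkeeping: for `δ < 1`, eventually in `L`,
`(1-δ)/2 · L² ≤ 2⌊(1-δ)L²/2⌋` (as real numbers). Indeed `2⌊y⌋ ≥ 2y - 2 ≥ y` as soon as
`y = (1-δ)L²/2 ≥ 2`, which holds for `L ≥ ⌈4/(1-δ)⌉ + 1` since then `L² ≥ L ≥ 4/(1-δ)`.
[folklore] -/
theorem eventually_half_density_le_natFloor {δ : ℝ} (hδ : δ < 1) :
    ∀ᶠ L : ℕ in atTop,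
      (1 - δ) / 2 * (L : ℝ) ^ 2 ≤ ((2 * ⌊(1 - δ) * (L : ℝ) ^ 2 / 2⌋₊ : ℕ) : ℝ) := by
  have hpos : 0 < 1 - δ := by linarith
  refine eventually_atTop.2 ⟨⌈4 / (1 - δ)⌉₊ + 1, fun L hL => ?_⟩
  set y : ℝ := (1 - δ) * (L : ℝ) ^ 2 / 2 with hy
  have hL1 : (1 : ℝ) ≤ L := by exact_mod_cast (by omega : 1 ≤ L)
  have hceil : (⌈4 / (1 - δ)⌉₊ : ℝ) ≤ L := by exact_mod_cast (by omega : ⌈4 / (1 - δ)⌉₊ ≤ L)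
  have hL4 : 4 / (1 - δ) ≤ (L : ℝ) := (Nat.le_ceil _).trans hceil
  have h4L : 4 ≤ (1 - δ) * (L : ℝ) := by
    have h := mul_le_mul_of_nonneg_left hL4 hpos.le
    rwa [mul_div_cancel₀ _ hpos.ne'] at h
  have hLsq : (1 - δ) * (L : ℝ) ≤ (1 - δ) * (L : ℝ) ^ 2 := by
    have : (L : ℝ) ≤ (L : ℝ) ^ 2 := by nlinarith
    exact mul_le_mul_of_nonneg_left this hpos.le
  have hy2 : 2 ≤ y := by rw [hy]; linarith
  have hfloor : y - 1 ≤ (⌊y⌋₊ : ℝ) := by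
    have := Nat.lt_floor_add_one y
    linarith
  have hgoal : (1 - δ) / 2 * (L : ℝ) ^ 2 = y := by rw [hy]; ring
  rw [hgoal]
  push_cast
  linarith

/-- **Proof of item stmt-HubbardSuperconductivity-0160 (`WcbcsSectorBookkeeping`).** The
hypothesis block `HYP(U, δ)` of the thesis gives, for every `L`, `IsNParticle (N L) (ψ L)` (the
joint sector `szSector (N L) 0` lies in the `N L`-particle sector, `mem_szSector_iff`) and
`‖ψ L‖ = 1` (verbatim), and the density bound `(1-δ)/2 · L² ≤ N L` eventually
(`eventually_half_density_le_natFloor`, using `δ < 1`). The coupling `U` and the ground-state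
property are not used beyond sector membership. Lieb, PRL 62 (1989) 1201. [folklore] -/
theorem wcbcsSectorBookkeeping_proof : WcbcsSectorBookkeeping := by
  intro U δ hδ N ψ hyp
  refine ⟨fun L => ⟨((mem_szSector_iff (N L) 0 (ψ L)).1 (hyp L).2.2.1).1, (hyp L).2.1⟩, ?_⟩
  filter_upwards [eventually_half_density_le_natFloor hδ.2] with L hL
  rw [(hyp L).1]
  exact hL

end Summit.HubbardSuperconductivity.WeakCouplingBCS
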